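import Summits.NavierStokesRegularity.OSWSelfSimilar.SheetRCentreOfRecord
import Summits.NavierStokesRegularity.OSWSelfSimilar.SheetRSpectrumOddAssemblyReal
import Summits.NavierStokesRegularity.OSWSelfSimilar.CertificateViscousSheetRSpectrum
import Mathlib.Analysis.Real.Pi.Bounds
import HarnessLib

/-!
# SHEET-ℝ frame: THE GAUGE LIFT OF RECORD `h = Σ_{n≤12} h_n e_n` as a kernel object — `h ∈ Wodd 8` and `‖h + 0i‖² ≤ hw2`
# (hypothesis-ledger rows #14 and #13 of the Z3-SR chain)

HONEST FRAMING (cell ns-blowup GROUP B / zone Z3, case Z3-SR-SPEC; 1-D MODEL certificate frame; not Euler/NS; «violates: none — MODEL»).  In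
`SheetRSpectrumCertifiedProfile.certifiedProfile_word` the rank-one gauge feedback `4⟪h, ·⟫h` is carried by `(hR : W 8) (hh : hR ∈ Wodd 8)` and
`hhw : ‖ofRealW 8 hR‖² ≤ hw2` (`hw2 = 71872713/10⁸`, `CertificateViscousSheetRSpectrum.hw2`; hypothesis-ledger rows #14 «the lift is odd — explicit
((1+cos θ)·Σ h_n sin nθ)» and #13).  The lift of record is the 12-mode frame combination with the FLOAT64 (hence exact dyadic) coefficients of cert-1's
spectral stage (`HOME/profile/cert/impl1/sheetR/spec/float/j262243/outputs/spec_float_L8_M4096_N1200.json`, key `h`; centre_sha16 c4de65e13d80c930;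
printed `h_w2 = 0.7187271233869…`).  This file TYPES it — `liftFun := frameCentre 8 12 liftCoeff 0` (no `T₂` part), `liftOfRecord : W 8` its `L²_w`
class — and proves:

* `liftOfRecord_mem_Wodd : liftOfRecord ∈ Wodd 8` (row #14; oddness of the frame, g12's `mem_Wodd_iff_ae`);
* `integral_weight_frameSum_sq` — `∫(L² + ξ²)(Σ d_i e_{i+1})² = 2L³π·Σ d_i²` (frame orthogonality `frame_orthogonal`), hence
  `norm_sq_liftOfRecord : ‖liftOfRecord‖² = 1024π·Σ h_n²` EXACTLY, `Σ h_n² = liftSumSq` an explicit rational;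
* **`norm_sq_ofRealW_liftOfRecord_le : ‖ofRealW 8 liftOfRecord‖² ≤ hw2`** (row #13) from `π < 3.14159265358979323847` (`Real.pi_lt_d20`; the margin is
  `6.6·10⁻⁹`, so the 7-digit bound would not do) and exact rational arithmetic.
Definitions: `liftTable` (12 dyadics), `liftCoeff`, `liftFun`, `liftOfRecord`, `liftSumSq`; no named fact.  WHAT THIS IS NOT: not NS; nothing about the
quality of the lift (it is cert-1's float negative direction turned exact); no certificate sentence is proved.
-/

noncomputable section

namespace Summit.NavierStokesRegularity.OSWSelfSimilar
namespace SheetRLiftOfRecord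

open _root_.MeasureTheory _root_.Real SheetRFrameCentre SheetRCentreOfRecord SheetRCertificateAssembly SheetREnergySpace SheetRAssemblyOperators
  SheetROddClass SheetRComplexPivot SheetRSpectrumOddAssemblyReal SheetRCayleySubstitution
open scoped InnerProductSpace

/-! ### §1 Data: the 12 dyadic coefficients -/

/-- The 12 frame coefficients `h_1..h_12` of the lift of record as `(p, e)`, `h_n = p/2^e` (exact values of the printed float64s). [folklore] -/
def liftTable : List (ℤ × ℕ) := [(7051456976644833, 60), (3550500704803743, 59), (7780976927020835, 60), (7298339348687223, 60),
  (6184982783244567, 60), (4801973779609909, 60), (1751397417709003, 59), (4865856233280743, 61), (6397574961901975, 62),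
  (1820301508000647, 61), (2789709766176893, 63), (8509342466398749, 67)]

/-- The coefficient function `i ↦ h_{i+1}` (real, `0` beyond the table). [folklore] -/
def liftCoeff (i : ℕ) : ℝ := ((liftTable.getD i (0, 0)).1 : ℝ) / (2 : ℝ) ^ (liftTable.getD i (0, 0)).2

/-- `Σ_{n≤12} h_n²` as an exact rational. [folklore] -/
def liftSumSq : ℚ := 4865568870715103056849956106307179593 / 21778071482940061661655974875633165533184

/-- **The lift as a function**: `h(ξ) = Σ_{i<12} h_{i+1}·e_{i+1}(ξ)` (a frame centre with `α = 0`). [folklore] -/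
def liftFun : ℝ → ℝ := frameCentre 8 12 liftCoeff 0

/-! ### §2 The weighted square integral of a frame sum -/

/-- A frame centre with `α = 0` is the bare frame sum. [folklore] -/
theorem frameCentre_zero_alpha (L : ℝ) (N : ℕ) (d : ℕ → ℝ) (ξ : ℝ) :
    frameCentre L N d 0 ξ = ∑ i ∈ Finset.range N, d i * frame L (i + 1) ξ := by
  rw [frameCentre, zero_mul, add_zero]

/-- `(L² + ξ²)·e_n·e_m` is integrable. [folklore] -/
theorem integrable_weight_frame_mul {L : ℝ} (hL : 0 < L) (n m : ℕ) :
    Integrable fun ξ : ℝ => (L ^ 2 + ξ ^ 2) * (frame L n ξ * frame L m ξ) := by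
  refine Integrable.mono' ((SheetRWeightedEmbeddings.integrable_inv_sq_add_sq hL).const_mul (4 * L ^ 4))
    ((by fun_prop : Continuous fun ξ : ℝ => L ^ 2 + ξ ^ 2).mul
      ((contDiff_frame' L n (k := 0)).continuous.mul (contDiff_frame' L m (k := 0)).continuous)).aestronglyMeasurable
    (Filter.Eventually.of_forall fun ξ => ?_)
  have hw : 0 < L ^ 2 + ξ ^ 2 := by positivity
  rw [Real.norm_eq_abs, abs_mul, abs_of_pos hw, abs_mul]
  have h1 := abs_frame_le' hL.ne' n ξ
  have h2 := abs_frame_le' hL.ne' m ξ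
  calc (L ^ 2 + ξ ^ 2) * (|frame L n ξ| * |frame L m ξ|)
      ≤ (L ^ 2 + ξ ^ 2) * (2 * L ^ 2 / (L ^ 2 + ξ ^ 2) * (2 * L ^ 2 / (L ^ 2 + ξ ^ 2))) := by
        refine mul_le_mul_of_nonneg_left (mul_le_mul h1 h2 (abs_nonneg _) (by positivity)) hw.le
    _ = 4 * L ^ 4 * (L ^ 2 + ξ ^ 2)⁻¹ := by field_simp; ring

/-- **`∫(L² + ξ²)·(Σ_{i<N} d_i e_{i+1})² = 2L³π·Σ_{i<N} d_i²`** (orthogonality `∫ w e_n e_m = 2L³π·δ_{nm}` of the frame). [folklore] -/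
theorem integral_weight_frameSum_sq {L : ℝ} (hL : 0 < L) (N : ℕ) (d : ℕ → ℝ) :
    ∫ ξ, (L ^ 2 + ξ ^ 2) * (∑ i ∈ Finset.range N, d i * frame L (i + 1) ξ) ^ 2 =
      2 * L ^ 3 * π * ∑ i ∈ Finset.range N, d i ^ 2 := by
  have hexp : ∀ ξ : ℝ, (L ^ 2 + ξ ^ 2) * (∑ i ∈ Finset.range N, d i * frame L (i + 1) ξ) ^ 2 =
      ∑ i ∈ Finset.range N, ∑ j ∈ Finset.range N, d i * d j * ((L ^ 2 + ξ ^ 2) * (frame L (i + 1) ξ * frame L (j + 1) ξ)) := by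
    intro ξ
    rw [pow_two (∑ i ∈ Finset.range N, d i * frame L (i + 1) ξ), Finset.sum_mul_sum, Finset.mul_sum]
    refine Finset.sum_congr rfl fun i _ => ?_
    rw [Finset.mul_sum]
    refine Finset.sum_congr rfl fun j _ => ?_
    ring
  simp_rw [hexp]
  rw [integral_finsetSum _ fun i _ => integrable_finsetSum _ fun j _ => (integrable_weight_frame_mul hL (i + 1) (j + 1)).const_mul _]
  rw [Finset.mul_sum]
  refine Finset.sum_congr rfl fun i hiN => ?_
  rw [integral_finsetSum _ fun j _ => (integrable_weight_frame_mul hL (i + 1) (j + 1)).const_mul _]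
  have hij : ∀ j ∈ Finset.range N, ∫ ξ, d i * d j * ((L ^ 2 + ξ ^ 2) * (frame L (i + 1) ξ * frame L (j + 1) ξ)) =
      if i = j then d i * d j * (2 * L ^ 3 * π) else 0 := by
    intro j _
    rw [integral_const_mul]
    have h := frame_orthogonal hL (n := i + 1) (m := j + 1) (Nat.succ_ne_zero i)
    simp only [frame] at h ⊢
    rw [h]
    by_cases hij : i = j
    · subst hij; simp
    · have : i + 1 ≠ j + 1 := by omega
      simp [hij]
  rw [Finset.sum_congr rfl hij, Finset.sum_ite_eq]
  have hi : i ∈ Finset.range N := hiN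
  rw [if_pos hi]
  ring

/-! ### §3 The lift as an element of `L²_w`, odd, with its norm -/

/-- `h` is a centre in the sense of `IsCentre` (so `∫(64 + ξ²)h² < ∞`, `h` odd, …). [folklore] -/
theorem isCentre_liftFun : IsCentre 8 liftFun (frameCentreDeriv 8 12 liftCoeff 0) (2 * (∑ i ∈ Finset.range 12, |liftCoeff i|) + 6 * |(0:ℝ)| / π) :=
  isCentre_frameCentre (by norm_num) 12 liftCoeff 0

/-- `h ∈ L²_w`. [folklore] -/
theorem memLp_liftFun : MemLp liftFun 2 (μw 8) :=
  memLp_W (contDiff_frameCentre (by norm_num : (0:ℝ) < 8) 12 liftCoeff 0 (k := 0)).continuous.aestronglyMeasurable isCentre_liftFun.weight₀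

/-- **THE LIFT OF RECORD** as an element of `W 8 = L²((64 + ξ²)dξ)`. [folklore] -/
def liftOfRecord : W 8 := memLp_liftFun.toLp liftFun

/-- Its representative is a.e. `liftFun`, and `‖h‖ = (∫(64 + ξ²)h²)^{1/2}`. [folklore] -/
theorem liftOfRecord_ae_and_norm :
    (((liftOfRecord : W 8) : ℝ → ℝ) =ᵐ[volume] liftFun) ∧ ‖liftOfRecord‖ = Real.sqrt (∫ y, ((8:ℝ) ^ 2 + y ^ 2) * liftFun y ^ 2) :=
  norm_toLp_W (by norm_num) memLp_liftFun

/-- **Row #14: the lift is odd**, `liftOfRecord ∈ Wodd 8`. [folklore] -/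
theorem liftOfRecord_mem_Wodd : liftOfRecord ∈ Wodd 8 := by
  rw [mem_Wodd_iff_ae (L := 8) (by norm_num)]
  have hae := liftOfRecord_ae_and_norm.1
  have hneg : (fun y => ((liftOfRecord : W 8) : ℝ → ℝ) (-y)) =ᵐ[volume] fun y => liftFun (-y) :=
    (Measure.measurePreserving_neg (volume : Measure ℝ)).quasiMeasurePreserving.ae_eq_comp hae
  filter_upwards [hae, hneg] with y hy hny
  rw [hny, hy]
  exact frameCentre_neg 12 liftCoeff 0 y

/-- **`‖h‖² = 1024π·Σ h_n²`** exactly. [folklore] -/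
theorem norm_sq_liftOfRecord : ‖liftOfRecord‖ ^ 2 = 2 * (8:ℝ) ^ 3 * π * ∑ i ∈ Finset.range 12, liftCoeff i ^ 2 := by
  rw [liftOfRecord_ae_and_norm.2, Real.sq_sqrt (integral_nonneg fun y => by positivity)]
  have hfun : (fun y : ℝ => ((8:ℝ) ^ 2 + y ^ 2) * liftFun y ^ 2) =
      fun y => ((8:ℝ) ^ 2 + y ^ 2) * (∑ i ∈ Finset.range 12, liftCoeff i * frame 8 (i + 1) y) ^ 2 := by
    funext y; rw [liftFun, frameCentre_zero_alpha]
  rw [hfun, integral_weight_frameSum_sq (by norm_num) 12 liftCoeff]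

/-- `Σ_{i<12} h_{i+1}² = liftSumSq` (exact rational arithmetic on the 12 dyadics). [folklore] -/
theorem sum_sq_liftCoeff : ∑ i ∈ Finset.range 12, liftCoeff i ^ 2 = ((liftSumSq : ℚ) : ℝ) := by
  simp only [Finset.sum_range_succ, Finset.sum_range_zero, liftCoeff, liftTable, List.getD_cons_succ, List.getD_cons_zero, liftSumSq]
  push_cast
  norm_num

/-- `‖ofRealW 8 u‖² = ‖u‖²` (the complexification is isometric on norms squared). [folklore] -/
theorem norm_sq_ofRealW (u : W 8) : ‖ofRealW 8 u‖ ^ 2 = ‖u‖ ^ 2 := by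
  have h := inner_ofRealW (L := 8) u u
  have h1 : (‖ofRealW 8 u‖ ^ 2 : ℝ) = RCLike.re ⟪ofRealW 8 u, ofRealW 8 u⟫_ℂ := (inner_self_eq_norm_sq (𝕜 := ℂ) _).symm
  rw [h1, h, ← real_inner_self_eq_norm_sq u]
  exact Complex.ofReal_re _

/-- **Row #13: `‖h + 0i‖² ≤ hw2`** (`hw2 = 71872713/10⁸`; uses `π < 3.14159265358979323847`). [folklore] -/
theorem norm_sq_ofRealW_liftOfRecord_le :
    ‖ofRealW 8 liftOfRecord‖ ^ 2 ≤ ((CertificateViscousSheetRSpectrum.hw2 : ℚ) : ℝ) := by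
  rw [norm_sq_ofRealW, norm_sq_liftOfRecord, sum_sq_liftCoeff, CertificateViscousSheetRSpectrum.hw2, liftSumSq]
  have hπ := Real.pi_lt_d20
  have hπ0 := Real.pi_pos
  push_cast
  nlinarith

end SheetRLiftOfRecord
end Summit.NavierStokesRegularity.OSWSelfSimilar

end
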